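import Mathlib
import Summits.Ventures.PercRepro2.SwOutMixedArmsDefs

/-!
# Counting predicates over a finite type (blind cell PercRepro2, night-4 g20, 2026-08-27;
proofs/NIGHT4-G20.md §4)

`N P = #{x : P x}` over a finite type, with the bookkeeping used by the several-arms big-block
lemma: counts of equivalent predicates agree (`N_congr`), counts are monotone (`N_mono`), a count
splits by any predicate (`N_split_pred`), a filtered finset's count is an `N` (`card_filter_eq_N`),
and the count of a predicate on a pair of distinct points (`N_pair`).  Everything is stated with
`N` so that the decidability instances of the filters never have to match syntactically.
-/

namespace Summit.Ventures.PercRepro2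

namespace MixedArms

open scoped Classical

section Count

variable {X : Type*} [Fintype X]

/-- The count of a predicate over a finite type. -/
noncomputable def N (P : X → Prop) : ℕ := (Finset.univ.filter P).card

/-- Counts of equivalent predicates agree. -/
lemma N_congr {P P' : X → Prop} (h : ∀ x, P x ↔ P' x) : N P = N P' := by
  unfold N
  congr 1
  apply Finset.filter_congr
  intro x _
  exact h x

/-- Counts are monotone in the predicate. -/
lemma N_mono {P P' : X → Prop} (h : ∀ x, P x → P' x) : N P ≤ N P' := by
  unfold N
  apply Finset.card_le_card
  intro x hx
  simp only [Finset.mem_filter, Finset.mem_univ, true_and] at hx ⊢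
  exact h x hx

/-- Splitting a count by an arbitrary predicate. -/
lemma N_split_pred (P D : X → Prop) : N P = N (fun x => P x ∧ D x) + N (fun x => P x ∧ ¬ D x) := by
  unfold N
  rw [← Finset.card_filter_add_card_filter_not (s := Finset.univ.filter P) (p := D)]
  congr 1
  · congr 1
    ext x
    simp only [Finset.mem_filter, Finset.mem_univ, true_and]
  · congr 1
    ext x
    simp only [Finset.mem_filter, Finset.mem_univ, true_and]

/-- A filtered finset's count is a count over the type. -/
lemma card_filter_eq_N (S : Finset X) (R : X → Prop) :
    (S.filter R).card = N (fun x => x ∈ S ∧ R x) := by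
  unfold N
  congr 1
  ext x
  simp only [Finset.mem_filter, Finset.mem_univ, true_and]

/-- The count of a predicate at a single point. -/
lemma N_single (a : X) (R : X → Prop) : N (fun x => x = a ∧ R x) = if R a then 1 else 0 := by
  unfold N
  by_cases h : R a
  · rw [if_pos h]
    apply Finset.card_eq_one.2
    refine ⟨a, ?_⟩
    ext x
    simp only [Finset.mem_filter, Finset.mem_univ, true_and, Finset.mem_singleton]
    constructor
    · exact fun hx => hx.1
    · rintro rfl
      exact ⟨rfl, h⟩
  · rw [if_neg h]
    apply Finset.card_eq_zero.2
    ext x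
    simp only [Finset.mem_filter, Finset.mem_univ, true_and, Finset.notMem_empty, iff_false]
    rintro ⟨rfl, hR⟩
    exact h hR

/-- The count of a predicate on a pair of distinct points. -/
lemma N_pair {a b : X} (hab : a ≠ b) (R : X → Prop) :
    N (fun x => (x = a ∨ x = b) ∧ R x) = (if R a then 1 else 0) + (if R b then 1 else 0) := by
  rw [N_split_pred (fun x => (x = a ∨ x = b) ∧ R x) (fun x => x = a)]
  have e1 : N (fun x => ((x = a ∨ x = b) ∧ R x) ∧ x = a) = N (fun x => x = a ∧ R x) := by
    apply N_congr
    intro x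
    constructor
    · rintro ⟨⟨-, hR⟩, hx⟩
      exact ⟨hx, hR⟩
    · rintro ⟨hx, hR⟩
      exact ⟨⟨Or.inl hx, hR⟩, hx⟩
  have e2 : N (fun x => ((x = a ∨ x = b) ∧ R x) ∧ ¬ x = a) = N (fun x => x = b ∧ R x) := by
    apply N_congr
    intro x
    constructor
    · rintro ⟨⟨hx | hx, hR⟩, hna⟩
      · exact absurd hx hna
      · exact ⟨hx, hR⟩
    · rintro ⟨hx, hR⟩
      refine ⟨⟨Or.inr hx, hR⟩, ?_⟩
      rw [hx]
      exact hab.symm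
  rw [e1, e2, N_single, N_single]

end Count

end MixedArms

end Summit.Ventures.PercRepro2
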